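import Mathlib

/-!
# The linear-algebra step of THEOREM B of ENGINE v16 'EIGENSCAN' (HodgeConjecture / FermatCycles cell, ftc-engine gen-19)

HONEST FRAMING: explicit algebraic cycles for specific Hodge classes on Fermat/Delsarte varieties;
residual open instances listed; no claim on general Hodge.

Memo `ftc/certs/W69/EIGENSCAN.md` §4.  On a coordinate stratum `S_J` of `ℙ⁴` the singular-point
system of the threefolds `Ψ_G = {f = G⁶}`, `G` in the PD-stable eigenclass, is a linear system
`A(y) c = r(y)` whose matrix factors as `A(y) = C · diag(d(y))` with a CONSTANT matrix `C` and units
`d_k(y)` (monomials that do not vanish on the stratum).  The engine decides solvability through the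
annihilator of the columns of `C`: if `v ᵥ* C = 0` then every solvable right-hand side satisfies
`v ⬝ᵥ r = 0`; the certificates of the memo then show that `v ⬝ᵥ r(y) = 0` for all such `v` forces
`f(y) = 0`.  This file records the two abstract steps (pointwise, over any commutative ring):
(1) `v ᵥ* C = 0 → C *ᵥ w = r → v ⬝ᵥ r = 0`, whatever the diagonal scaling hidden in `w`;
(2) the contrapositive used by the scan: a right-hand side with `v ⬝ᵥ r ≠ 0` has no solution.
-/

namespace Summit.HodgeConjecture.FermatCycles.EigenscanBoundary

open Matrix

variable {R : Type*} [CommRing R] {m n : Type*} [Fintype m] [Fintype n]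

/-- If `v` annihilates the columns of `C` (`v ᵥ* C = 0`), then `v` is orthogonal to every vector in
the column space: `C *ᵥ w = r → v ⬝ᵥ r = 0`. -/
theorem dotProduct_eq_zero_of_vecMul_eq_zero (C : Matrix m n R) (v : m → R) (hv : v ᵥ* C = 0)
    {w : n → R} {r : m → R} (h : C *ᵥ w = r) : v ⬝ᵥ r = 0 := by
  rw [← h, dotProduct_mulVec, hv, zero_dotProduct]

/-- The form used for the strata: the matrix is `C` with its columns rescaled by arbitrary factors
`d k` (on the stratum: non-vanishing monomials), i.e. the unknowns enter as `d k * c k`.  A right-hand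
side `r` with `v ⬝ᵥ r ≠ 0` for some `v` with `v ᵥ* C = 0` admits NO solution `c`. -/
theorem no_solution_of_annihilator (C : Matrix m n R) (d : n → R) (v r : m → R)
    (hv : v ᵥ* C = 0) (hr : v ⬝ᵥ r ≠ 0) : ¬ ∃ c : n → R, C *ᵥ (fun k => d k * c k) = r := by
  rintro ⟨c, hc⟩
  exact hr (dotProduct_eq_zero_of_vecMul_eq_zero C v hv hc)

/-- Conversely (the direction that makes the criterion an equivalence when the `d k` are units and
the annihilator is the full left kernel is not needed by the engine); what IS used pointwise is the
linear consequence: if `r = C *ᵥ w` is solvable and `f = ∑ᵥ λᵥ • (v ⬝ᵥ r)` is a combination of the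
annihilator pairings, then `f = 0`.  Stated for a finite family of annihilating vectors. -/
theorem combination_eq_zero {ι : Type*} (s : Finset ι) (C : Matrix m n R) (vs : ι → m → R)
    (hvs : ∀ i ∈ s, vs i ᵥ* C = 0) (lam : ι → R) {w : n → R} {r : m → R} (h : C *ᵥ w = r) :
    ∑ i ∈ s, lam i * (vs i ⬝ᵥ r) = 0 := by
  refine Finset.sum_eq_zero fun i hi => ?_
  rw [dotProduct_eq_zero_of_vecMul_eq_zero C (vs i) (hvs i hi) h, mul_zero]

end Summit.HodgeConjecture.FermatCycles.EigenscanBoundary
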